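import Summits.BirchSwinnertonDyer.BirchSwinnertonDyer.Theorems.EisensteinPrimesBSDpOnCellCTelescopeK2RefinedLocalDefect
import Literature.NumberTheory.EllipticCurves.BigGaloisRepSelmer
import Literature.NumberTheory.GaloisRepresentations.DecompositionGroupOfCompletion
import HarnessLib

/-!
# Crux 4 `BSDpOnCellC` (stmt-BirchSwinnertonDyer-19034), line `telescope`, leaf N2 `stub_weightTwoControl` (W2) / N3′: the REFINED
# torsion-defect control INSTANTIATED ON THE K2 SELMER STRUCTURE `localMap K` / `strictSet p 𝔮 Σ` — at every inertia index `Sum.inr w`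
# the hypothesis `hkill` is only required for invariants whose class mod `r` is fixed by the DECOMPOSITION group `Γ_{K_w}`
# (through `localMap K (Sum.inl w)`; `localMap K (Sum.inr w) = localMap K (Sum.inl w) ∘ inertiaIncl K w` by definition and
# `I_{K_w} ⊴ Γ_{K_w}`, tree `absInertia_normal_holds`) (helper, `--supports stmt-BirchSwinnertonDyer-19034 --as helper`; closes nothing)

Cell `bsd-eis`, width seat `bsd-line-x2-p2` (prover g19, 2026-08-29; D-0154 KEY row 5). THEOREMS ONLY: no definition, no named
fact, no `sorry`, no instance, no notation. The K2-currency form of this seat's `TelescopeK2RefinedLocalDefect.exists_invariant_δ₀_eq_of_factor`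
(p749947): no dependent index families — the two kinds of indices of `LocalIndex K = HOS ⊕ HOS` are treated by cases inside the proof.

* **`smul_mem_map_torsionInclH1_selmer_strictSet_refined`** — for ANY discrete `A`-linear `ρ : Γ_K → Aut(M)` with `M` `r`-divisible
  (e.g. `ρ = AnticyclotomicBigGaloisRep κ ρ₂`, `r = C X`), strict prime `𝔮`, set `Σ`, scalar `s`: if (decomposition index) `s` kills the
  `r`-cotorsion of `(M|_{Γ_{K_𝔮}})^{Γ_{K_𝔮}}` and (inertia indices `w ∉ Σ`, `w ∤ p`) for every `m ∈ (M|_{I_{K_w}})^{I_{K_w}}` with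
  `ρ(res_{K_w} d) m − m ∈ r • (M|_{I_{K_w}})^{I_{K_w}}` for all `d ∈ Γ_{K_w}` there is an invariant `m'` with `r • m' = s • m`, then
  `s • y ∈ H¹(ι)(Sel(M[r]))` for every `r`-torsion `y ∈ Sel(M) = TorsionControl.selmer (localMap K) (strictSet p 𝔮 Σ) ρ`.

With p750160 (`TelescopeK2TwistedFixedAnnihilator.exists_C_smul_eq_aeval_smul_invariants_restrict`, the refined `hkill` at a ramified `w`
from an annihilating polynomial of `Frob_w`) and p747667/p747781 (the decomposition index) this is the cokernel half of sub-leaf W2's weight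
control WITHOUT the inertia clause (inert) of p749092, at the price of the arithmetic inputs (a)(b)(c) of memo #52/STATUS l.6376.

HONEST FRAMING: cohomological bookkeeping over binders; nothing about any curve is asserted; BSD is proved for no pair; no registered stub,
crux or summit statement is proved by this file; closes: none.

References: [JetchevSkinnerWan2017] §3.4, Lemma 3.4.1 (arXiv:1512.06894 p. 14); [Ochiai2006] Prop. 5.1 (Compositio 142 p. 1177: the local
terms `((A^{I_v})_J)^{G_{ℚ_v}}`); [SerreLocalFields1979] Ch. I §7 Prop. 20 (`I ⊴ D`); [Castella2018] Def. 2.2 (the Selmer structure).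
-/

noncomputable section

-- D-0017: single-problem summit, the namespace repeats the problem name by design.
set_option linter.dupNamespace false
set_option autoImplicit false

open CategoryTheory Field IsDedekindDomain NumberField
open Literature.NumberTheory.GaloisRepresentations Literature.NumberTheory.EllipticCurves
open Literature.NumberTheory.EllipticCurves.BigGaloisRep (localMap strictSet LocalIndex LocalGroup inertiaIncl
  inl_mem_strictSet_iff)
open scoped ContRepresentation Pointwise

universe u

namespace Summit.BirchSwinnertonDyer.BirchSwinnertonDyer.Theorems.TelescopeK2RefinedControlStrictSet

open Summit.BirchSwinnertonDyer.Rank1Residual.X11b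
open Summit.BirchSwinnertonDyer.Rank1Residual.X11b.TorsionControl

variable {K : Type u} [Field K] [NumberField K] {p : ℕ}
  {A : Type*} [CommRing A] [TopologicalSpace A]
  {M : Type u} [AddCommGroup M] [Module A M] [TopologicalSpace M] [DiscreteTopology M] [ContinuousSMul A M]
  (ρ : ContinuousRep (absoluteGaloisGroup K) A M) (𝔮 : HeightOneSpectrum (𝓞 K)) (Sig : Set (HeightOneSpectrum (𝓞 K)))
  (r s : A)

/-- **Refined Lemma 3.4.1 on the K2 Selmer structure.** See the module docstring: p743708's conclusion with `hkill` at the inertia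
indices `Sum.inr w` demanded only for invariants whose class mod `r` is fixed by `Γ_{K_w}` (through `localMap K (Sum.inl w)`).
[cite: JetchevSkinnerWan2017, §3.4, Lemma 3.4.1 (arXiv:1512.06894 p. 14)] [cite: Ochiai2006, Prop. 5.1 (Compositio 142 p. 1177)]
[cite: SerreLocalFields1979, Ch. I §7 Prop. 20] -/
theorem smul_mem_map_torsionInclH1_selmer_strictSet_refined (hr : Function.Surjective fun m : M => r • m)
    (hkill_inl : ∀ w : HeightOneSpectrum (𝓞 K), (Sum.inl w : LocalIndex K) ∈ strictSet p 𝔮 Sig →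
      ∀ m ∈ ((ρ.restrict (localMap K (Sum.inl w))).toTopRep).ρ.invariants,
        ∃ m' ∈ ((ρ.restrict (localMap K (Sum.inl w))).toTopRep).ρ.invariants, r • m' = s • m)
    (hkill_inr : ∀ w : HeightOneSpectrum (𝓞 K), (Sum.inr w : LocalIndex K) ∈ strictSet p 𝔮 Sig →
      ∀ m ∈ ((ρ.restrict (localMap K (Sum.inr w))).toTopRep).ρ.invariants,
        (∀ d : LocalGroup K (Sum.inl w), ρ (localMap K (Sum.inl w) d) m - m ∈
          r • ((ρ.restrict (localMap K (Sum.inr w))).toTopRep).ρ.invariants) →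
        ∃ m' ∈ ((ρ.restrict (localMap K (Sum.inr w))).toTopRep).ρ.invariants, r • m' = s • m)
    {y : continuousCohomology 1 ρ.toTopRep} (hy : y ∈ selmer (localMap K) (strictSet p 𝔮 Sig) ρ) (hyr : r • y = 0) :
    s • y ∈ Submodule.map (torsionInclH1 ρ r) (selmer (localMap K) (strictSet p 𝔮 Sig) (torsionRep ρ r)) := by
  obtain ⟨x, hx⟩ := exists_cohomologyMap_torsionIncl_eq ρ r hr y hyr
  have hd : ∀ v ∈ strictSet p 𝔮 Sig, resH1 (torsionRep ρ r) (localMap K v) (s • x) = 0 := by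
    intro v hv
    have h0 : cohomologyMap (torsionIncl (ρ.restrict (localMap K v)) r) 1 (resH1 (torsionRep ρ r) (localMap K v) x) = 0 := by
      have h := resH1_cohomologyMap (localMap K v) (torsionIncl ρ r) x
      rw [hx] at h
      change (cohomologyMap (restrictHom (localMap K v) (torsionIncl ρ r)) 1) (resH1 (torsionRep ρ r) (localMap K v) x) = 0
      rw [← h]
      exact (mem_selmer_iff (localMap K) (strictSet p 𝔮 Sig) ρ _).1 hy v hv
    -- an invariant `w` with `δ₀ w = res_v x`, refined at the inertia indices
    obtain ⟨w, hw, hw'⟩ : ∃ w : ↥((ρ.restrict (localMap K v)).toTopRep.ρ.invariants),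
        (isSES_torsion (ρ.restrict (localMap K v)) r hr).δ₀ w = resH1 (torsionRep ρ r) (localMap K v) x ∧
        ∃ m' ∈ ((ρ.restrict (localMap K v)).toTopRep).ρ.invariants, r • m' = s • (w : M) := by
      rcases v with w | w
      · -- decomposition index (only `w = 𝔮` occurs); trivial factorization
        obtain ⟨w₀, hw₀, -⟩ := TelescopeK2RefinedLocalDefect.exists_invariant_δ₀_eq_of_factor ρ r
          (localMap K (Sum.inl w)) (localMap K (Sum.inl w)) (ContinuousMonoidHom.id _) hr (fun _ => rfl)
          (fun (d : absoluteGaloisGroup (w.adicCompletion K)) (h : absoluteGaloisGroup (w.adicCompletion K)) =>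
            ⟨d⁻¹ * h * d, rfl⟩) x h0
        exact ⟨w₀, hw₀, hkill_inl w hv w₀.1 w₀.2⟩
      · -- inertia index: factor through `Γ_{K_w}`, `I_{K_w}` normal
        have hN : (absInertia (w.adicCompletion K)).Normal := absInertia_normal_holds (w.adicCompletion K)
        obtain ⟨w₀, hw₀, hD⟩ := TelescopeK2RefinedLocalDefect.exists_invariant_δ₀_eq_of_factor ρ r
          (localMap K (Sum.inr w)) (localMap K (Sum.inl w)) (inertiaIncl K w) hr (fun _ => rfl)
          (fun (d : absoluteGaloisGroup (w.adicCompletion K)) (h : ↥(absInertia (w.adicCompletion K))) =>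
            ⟨⟨d⁻¹ * (h : absoluteGaloisGroup (w.adicCompletion K)) * d, by
              have := hN.conj_mem _ h.2 d⁻¹
              simpa using this⟩, rfl⟩) x h0
        exact ⟨w₀, hw₀, hkill_inr w hv w₀.1 w₀.2 hD⟩
    obtain ⟨m', hm', hm'eq⟩ := hw'
    have h1 : (isSES_torsion (ρ.restrict (localMap K v)) r hr).δ₀ (s • w) = 0 := by
      rw [(isSES_torsion (ρ.restrict (localMap K v)) r hr).δ₀_eq_zero_iff]
      exact ⟨m', hm', hm'eq⟩
    rw [map_smul] at h1
    rw [map_smul, ← hw]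
    exact h1
  have hmem : s • x ∈ selmer (localMap K) (strictSet p 𝔮 Sig) (torsionRep ρ r) :=
    (mem_selmer_iff (localMap K) (strictSet p 𝔮 Sig) _ _).2 hd
  exact Submodule.mem_map.2 ⟨s • x, hmem, by rw [map_smul, torsionInclH1_apply, hx]⟩

end Summit.BirchSwinnertonDyer.BirchSwinnertonDyer.Theorems.TelescopeK2RefinedControlStrictSet

end
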